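import Summits.CriticalPhenomena.PercolationContinuityZ3.Theorems.PercNearOneGluingNoHeavyLowerTailSahiMixtureLaw
import Literature.Combinatorics.Sahi2008.Chains
import HarnessLib

/-!
# The all-equal family: TOP at every order, and the failure of the `(1 − h)²` comparison at order `58`

Support file of the one-cut programme (crux `NoHeavyLowerTail`, stmt-CriticalPhenomena-4575; cell `prim-masterthm`, seat P3, gen 15;
`run/shared/lean/prim/prim-masterthm/prim-masterthm-p3/HIERARCHY.md` §23; memo
`run/shared/lean/prim/prim-masterthm/FROM-prim-masterthm-p3-g15-MONOTONE-MIXTURES.md` §4).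

CONTEXT.  `TopRowConjecture` (`…SahiMixtureTopRow`, gens 6/13): `E_m(A) ≥ 0 ⇒ h ↦ E_m(A_0 ∪ H,…,A_{m−1} ∪ H)` is Bernstein-positive of degree `m`
(`H` an independent coin of bias `h`).  For `m ≤ 10` it was ESTABLISHED through the stronger "N-form": the Bernstein coefficients `N_j` of
`N(h) := E_m(A ∪ H) − (1 − h)²·E_m(A)` are `≥ 0` for EVERY law (coefficientwise in the atoms for `m ≤ 10`: gen 13's censuses), which in
particular gives the VALUE comparison `E_m(A_0 ∪ H,…,A_{m−1} ∪ H) ≥ (1 − h)²·E_m(A_0,…,A_{m−1})`.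

THIS FILE (everything PROVED, standard axioms):
* `sahiE_const_of_idem` — `E_{n+1}(f,…,f) = (Π_{i<n}(n − i − E f))·E f` for an idempotent `f` (the tree's chain product formula `Sahi2008.sahiE_chain`
  with all members equal); `sahiE_orCoin_const_eq` — the all-members OR-coin cell of `m` copies of ONE event in closed form.
* **`bernsteinPos_orCoin_const`** — TOP at EVERY order `m` for the all-equal family `A_0 = ⋯ = A_{m−1} = A` under every probability weight: the cell
  is a product of `m` affine factors with nonnegative endpoint values (`BernsteinPos.finProd`).
* **`topRow_sq_comparison_fails_58`** — at `m = 58`, for `58` copies of an event of probability `1/2` and `h = 1/16`: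
  `E_58((1_{A∪H})^{58}) < (1 − h)²·E_58((1_A)^{58})` although `E_58((1_A)^{58}) > 0` (`sahiE_const_pos_58`).  Hence the N-form of TOP-ROW (and the
  coefficientwise route CTR of gens 13/14) is FALSE from order `58` on (numerically the first failure of `N_1 ≥ 0` is `m = 57`, `μ(Aᶜ) = 0.47`:
  `N_1 = q·Π_{i=1}^{m−2}(i+q)·[1 − q(1−q)Σ_{i=1}^{m−2} 1/(i+q)]`), while `TopRowConjecture` itself is NOT refuted — for this very family the cell is
  Bernstein-positive at every order (previous bullet).  METHOD RECORD: no argument comparing the cell with `(1−h)²·E_m(A)` (or with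
  `λ^a·E_m(A)` for any fixed `a`, since `E_m(A∪H)/E_m(A) → 0` as `m → ∞` at fixed `h` for this family) can prove TOP-ROW for all `m`.
HONEST FRAMING: nothing here bears on (M⁺-k)/`C_k`; these are exact identities for one repeated event. [this work]
-/

noncomputable section

open scoped Classical

namespace Summit.CriticalPhenomena.PercolationContinuityZ3.Theorems

open Finset Function
open Literature.Combinatorics.Sahi2008
open Literature.Probability.Percolation.DecisionTree (ind ind_of_mem ind_of_not_mem ind_nonneg)

namespace SahiMixture

variable {α : Type*} [Fintype α]

/-! ### Closed forms for a repeated idempotent member -/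

/-- `E_{n+1}(f,…,f) = (Π_{i<n} (n − i − E f))·E f` for an idempotent function `f` (in particular an indicator) under an arbitrary weight — the chain
product formula with all members equal. [this work] -/
theorem sahiE_const_of_idem (μ : α → ℝ) (n : ℕ) (f : α → ℝ) (hf : f * f = f) :
    sahiE μ (n + 1) (fun _ : Fin (n + 1) => f) = (∏ i : Fin n, ((n : ℝ) - (i : ℕ) - ex μ f)) * ex μ f :=
  sahiE_chain μ n (fun _ => f) fun _ _ _ => hf

omit [Fintype α] in
/-- Indicators are idempotent. [folklore] -/
theorem ind_mul_self (A : Set α) : ind A * ind A = ind A := by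
  funext x
  by_cases hx : x ∈ A
  · simp [ind_of_mem hx]
  · simp [ind_of_not_mem hx]

/-- The coin moment of the OR-ed event: `E_{μ⊗coin(h)}[1_{A∪H}] = (1 − h)·μ(A) + h` for a probability weight `μ`. [this work] -/
theorem ex_coinWeight_ind_orCoin (μ : α → ℝ) (hμ1 : ∑ a, μ a = 1) (A : Set α) (h : ℝ) :
    ex (coinWeight μ h) (ind (orCoin A true)) = (1 - h) * ex μ (ind A) + h := by
  rw [ex_coinWeight]
  simp only [ind_orCoin_false, ind_orCoin_true, cond_true]
  rw [ex_const hμ1, mul_one]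

/-- **The all-members OR-coin cell of `n+1` copies of one event, in closed form**:
`E_{n+1}((1_{A∪H})^{n+1}) = (Π_{i<n} (n − i − p_h))·p_h`, `p_h = (1 − h)·μ(A) + h`. [this work] -/
theorem sahiE_orCoin_const_eq (μ : α → ℝ) (hμ1 : ∑ a, μ a = 1) (A : Set α) (n : ℕ) (h : ℝ) :
    sahiE (coinWeight μ h) (n + 1) (fun _ : Fin (n + 1) => ind (orCoin A true))
      = (∏ i : Fin n, ((n : ℝ) - (i : ℕ) - ((1 - h) * ex μ (ind A) + h))) * ((1 - h) * ex μ (ind A) + h) := by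
  rw [sahiE_const_of_idem _ n _ (ind_mul_self _), ex_coinWeight_ind_orCoin μ hμ1]

/-! ### TOP at every order for the all-equal family -/

/-- Finite products of Bernstein-positive functions of degree `1` are Bernstein-positive of degree = the number of factors. [folklore] -/
theorem BernsteinPos.finProd : ∀ (n : ℕ) (Φ : Fin n → ℝ → ℝ), (∀ i, BernsteinPos 1 (Φ i)) → BernsteinPos n (fun h => ∏ i, Φ i h)
  | 0, Φ, _ => by
    simpa using bernsteinPos_const 0 zero_le_one
  | n + 1, Φ, hΦ => by
    have ih := BernsteinPos.finProd n (fun i => Φ i.castSucc) fun i => hΦ i.castSucc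
    have := BernsteinPos.mul ih (hΦ (Fin.last n))
    refine this.congr fun h _ _ => ?_
    rw [Fin.prod_univ_castSucc]

/-- **TOP at every order for the all-equal family.**  For every probability weight, every event `A` and every `m`, the all-members OR-coin cell
`h ↦ E_m(μ ⊗ coin(h); 1_{A∪H},…,1_{A∪H})` is Bernstein-positive of degree `m`: by the closed form it is the product of the affine factors
`(n − i) − p_h = (1−h)(n − i − μ(A)) + h(n − i − 1)` (`i < n`) and `p_h = (1−h)μ(A) + h`, all with nonnegative endpoint values. [this work] -/
theorem bernsteinPos_orCoin_const {μ : α → ℝ} (hμ0 : ∀ a, 0 ≤ μ a) (hμ1 : ∑ a, μ a = 1) (A : Set α) :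
    ∀ m : ℕ, BernsteinPos m (fun h => sahiE (coinWeight μ h) m (fun _ : Fin m => ind (orCoin A true)))
  | 0 => by simpa [sahiE_zero] using bernsteinPos_const 0 le_rfl
  | n + 1 => by
    have hp0 : 0 ≤ ex μ (ind A) := ex_nonneg hμ0 fun a => ind_nonneg A a
    have hp1 : ex μ (ind A) ≤ 1 := by
      calc ex μ (ind A) ≤ ex μ (fun _ => (1 : ℝ)) := ex_mono hμ0 fun a => by
              by_cases ha : a ∈ A
              · simp [ind_of_mem ha]
              · simp [ind_of_not_mem ha]
        _ = 1 := ex_const hμ1 1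
    -- the `n` leading factors, each affine with endpoint values `n − i − μ(A) ≥ 0` and `n − i − 1 ≥ 0`
    have hfac : BernsteinPos n (fun h => ∏ i : Fin n, ((n : ℝ) - (i : ℕ) - ((1 - h) * ex μ (ind A) + h))) := by
      refine BernsteinPos.finProd n _ fun i => ?_
      have hi : ((i : ℕ) : ℝ) + 1 ≤ (n : ℝ) := by exact_mod_cast Nat.succ_le_of_lt i.isLt
      refine (bernsteinPos_affine (x := (n : ℝ) - (i : ℕ) - ex μ (ind A)) (y := (n : ℝ) - (i : ℕ) - 1)
        (by linarith) (by linarith)).congr fun h _ _ => ?_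
      ring
    have hlast : BernsteinPos 1 (fun h => (1 - h) * ex μ (ind A) + h) :=
      (bernsteinPos_affine hp0 zero_le_one).congr fun h _ _ => by ring
    exact (BernsteinPos.mul hfac hlast).congr fun h _ _ => sahiE_orCoin_const_eq μ hμ1 A n h

/-! ### The `(1 − h)²` comparison fails at order `58` -/

/-- The fair-coin weight on `Bool`. [folklore] -/
private theorem sum_half_bool : ∑ _b : Bool, (1 / 2 : ℝ) = 1 := by
  rw [Fintype.sum_bool]; norm_num

/-- Under the fair-coin weight on `Bool`, the event `{true}` has probability `1/2`. [folklore] -/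
private theorem ex_half_ind_true : ex (fun _ : Bool => (1 / 2 : ℝ)) (ind ({true} : Set Bool)) = 1 / 2 := by
  rw [ex_def, Fintype.sum_bool, ind_of_mem (show true ∈ ({true} : Set Bool) from rfl),
    ind_of_not_mem (show false ∉ ({true} : Set Bool) by simp)]
  norm_num

/-- `E_58` of `58` copies of an event of probability `1/2` is POSITIVE (`= ½·Π_{k=1}^{57}(k − ½)`): the top row holds strictly here. [this work] -/
theorem sahiE_const_pos_58 :
    0 < sahiE (fun _ : Bool => (1 / 2 : ℝ)) 58 (fun _ : Fin 58 => ind ({true} : Set Bool)) := by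
  rw [show (58 : ℕ) = 57 + 1 from rfl, sahiE_const_of_idem _ 57 _ (ind_mul_self _), ex_half_ind_true]
  refine mul_pos (Finset.prod_pos fun i _ => ?_) (by norm_num)
  have hi : ((i : ℕ) : ℝ) + 1 ≤ (57 : ℕ) := by exact_mod_cast Nat.succ_le_of_lt i.isLt
  push_cast at hi ⊢
  linarith

/-- **The `(1 − h)²` comparison behind the N-form of TOP-ROW fails at order `58`.**  For `58` copies of an event `A` of probability `1/2` and an
independent coin `H` of bias `h = 1/16`:  `E_58(1_{A∪H},…,1_{A∪H}) < (1 − h)²·E_58(1_A,…,1_A)`.  Consequently the Bernstein coefficient vector of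
`E_m(A∪H) − (1−h)²E_m(A)` is NOT nonnegative for every law at `m = 58` (a Bernstein-positive function is `≥ 0` on `[0,1]`), i.e. the N-form / CTR
route to `TopRowConjecture` is dead for large `m` — although the top row is positive here (`sahiE_const_pos_58`) and the cell itself IS
Bernstein-positive (`bernsteinPos_orCoin_const`).  Both sides are explicit products of `57 + 1` rationals (`sahiE_orCoin_const_eq`,
`sahiE_const_of_idem`), compared by `norm_num`. [this work] -/
theorem topRow_sq_comparison_fails_58 :
    sahiE (coinWeight (fun _ : Bool => (1 / 2 : ℝ)) (1 / 16)) 58 (fun _ : Fin 58 => ind (orCoin ({true} : Set Bool) true))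
      < (1 - 1 / 16) ^ 2 * sahiE (fun _ : Bool => (1 / 2 : ℝ)) 58 (fun _ : Fin 58 => ind ({true} : Set Bool)) := by
  rw [show (58 : ℕ) = 57 + 1 from rfl, sahiE_orCoin_const_eq _ sum_half_bool, sahiE_const_of_idem _ 57 _ (ind_mul_self _),
    ex_half_ind_true]
  rw [Fin.prod_univ_eq_prod_range (fun i => ((57 : ℕ) : ℝ) - (i : ℕ) - ((1 - 1 / 16) * (1 / 2 : ℝ) + 1 / 16)) 57,
    Fin.prod_univ_eq_prod_range (fun i => ((57 : ℕ) : ℝ) - (i : ℕ) - (1 / 2 : ℝ)) 57]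
  simp only [Finset.prod_range_succ, Finset.prod_range_zero]
  norm_num

/-- **The N-form of TOP-ROW is false (existential form, order `58`).**  There are a finite probability weight, an event with `E_58 ≥ 0` for its
`58`-fold repetition, and a bias `h ∈ [0,1]` at which the all-members OR-coin cell drops below `(1 − h)²` times the top row. [this work] -/
theorem exists_topRow_sq_comparison_fails :
    ∃ (μ : Bool → ℝ) (A : Set Bool) (h : ℝ), (∀ b, 0 ≤ μ b) ∧ ∑ b, μ b = 1 ∧ 0 ≤ h ∧ h ≤ 1 ∧
      0 ≤ sahiE μ 58 (fun _ : Fin 58 => ind A) ∧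
      sahiE (coinWeight μ h) 58 (fun _ : Fin 58 => ind (orCoin A true)) < (1 - h) ^ 2 * sahiE μ 58 (fun _ : Fin 58 => ind A) :=
  ⟨fun _ => 1 / 2, {true}, 1 / 16, fun _ => by norm_num, sum_half_bool, by norm_num, by norm_num, sahiE_const_pos_58.le,
    topRow_sq_comparison_fails_58⟩

end SahiMixture

end Summit.CriticalPhenomena.PercolationContinuityZ3.Theorems

end
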